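import Summits.ABC.IUTFork.Cor312PilotIdelesM
import Summits.ABC.IUTFork.Cor312ThetaLocalLeContentHull
import HarnessLib

/-!
# [IUTchIII] Corollary 3.12 at the M-LEVEL sharp setting (summand route) — the Θ-side local term at `(i+1, u)` is bounded
# by the CONTENT HULLS `Σ_{v⃗} Pr(v⃗)·(−m(v⃗)·log p_u + log μ̄_{v⃗}(hull(log_p(R_{v⃗}^×))))` (G1-Θ unit P6-instA, «GO s2-p8 hA-summand»)

PROOF-ONLY record file (D-0012; no definitions) of the abc-iut cell (R2 S-chain team, seat abc-iut-s2-p8; branch C «abc ⇐ S»,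
C-lead ruling C-R12 (e) «target #2′: the M-level (V̲, K_{v̲}) real volume setting»; unit P6-instA named by the G1-Θ lead
abc-iut-w5-d166, 10:45:36Z). TAKES NO SIDE on [IUTchIII] Cor. 3.12.

abc-iut-s2-p7's GENERIC (U1)-HULL bound `Cor312Vol.thetaLocal_untopD_le_sum_content_hull` (`Cor312ThetaLocalLeContentHull`, p437184):
for ANY typed setting `P` with abc-iut-c312-6's `BridgeHyps` and ANY `p`-adic presentation `Pr` of its packet at `v_ℚ` whose
frame at `(i+1, v_ℚ)` is the pulled-back real frame and whose log-volume on product regions is `Pr`'s weighted summand log-measure,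
if the (Ind3)-region lies in `e⁻¹(Π_{v⃗} p^{m(v⃗)}·log_p(R_{v⃗}^×))` for a capsule-symmetric `m`, then
`−|log(Θ)|_{i+1,v_ℚ} ≤ Σ_{v⃗} w(v⃗)·(−m(v⃗)·log p + log μ̄_{v⃗}(hull(log_p(R_{v⃗}^×))))` ([IUTchIV] Thm. 1.10 Step (v)). THIS file is its
INSTANCE at this seat's summand-route M-level sharp setting `settingPrVolSharpM` (`Cor312PilotIdelesM`, p438078) over
abc-iut-w5-d166's presentation `presAtM D hlog u` at `v_ℚ = u`, `p = p_u` (`Cor312FrameVolumePiecesM`, p434705), for GENERIC Θ-ideles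
`t` (non-zero, units off a finite set `S_Θ` of rational places): `hframe` is `rfl` (abc-iut-c312-7's `Setting.ofComparison` frame =
`HullFrame.ofComparison` of abc-iut-w4-d013's M-level field-factor pieces = the presentation's), `hvol` is abc-iut-c312-5's
`SummandPieces.logvol_preimage_pi` for abc-iut-w4-d013's container `summandPiecesPrM` (p435693; weights = abc-iut-w5-d166's
`V_mod` probability weights `weightM`), `BridgeHyps` is this seat's `bridgeHyps_settingPrVolSharpM_of_ideles` (every field a
theorem), and `h3` holds because the (Ind3)-region IS `e⁻¹(Π_{v⃗} ι_{i+1}(t_{Θ,i+1,v̲_{i+1}})·(R_I)^∼)` (the sharp box, constant in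
`m`: Dupuy–Hilado §4.10) and the last-slot box lies in the SLOT UNION `⋃_a ι_a(t_{Θ,i+1,v̲_a})·(R_I)^∼`:

* **`thetaLocal_settingPrVolSharpM_untopD_le_sum_content`**: for every capsule-symmetric content family `m` with
  `⋃_a ι_a(t_{Θ,i+1,v̲_a})·(R_I)^∼ ⊆ p_u^{m(v⃗)}·log_p(R_{v⃗}^×)` at every summand `v⃗`,
  `(−|log(Θ)|_{i+1,u}).untopD 0 ≤ Σ_{v⃗} weightM(v⃗)·(−m(v⃗)·log p_u + log μ̄_{v⃗}(hull(log_{p_u}(R_{v⃗}^×))))` — the hypothesis (hA)-shape of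
  abc-iut-w5-d166's `negLogTheta_le_genuine_of_local_bounds` (`Cor312ThetaSideAssemblyM`, p438195) up to the identification of this
  right-hand side with the orbit sum `orbitSumM` (unit P6-instB: `m :=` the CONTENTS of the slot unions, abc-iut-c312-3's
  `exists_content` / `packetLogμ_packetHull_zpow_smul_logPacket`); the `WithTop` form `thetaLocal_settingPrVolSharpM_le_coe_sum_content`
  (abc-iut-s2-p7 `thetaLocal_le_coe_of_untopD_le`); and, through abc-iut-w4-d013's two-routes identity (p437121), the SAME bound for the
  lead's frames-route `settingMSharp` (`thetaLocal_settingMSharp_untopD_le_sum_content`, `…_le_coe_…`).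

[cite: Mochizuki2012, IUTchIII Cor. 3.12 p. 173–174; IUTchIV Thm. 1.10 Step (v) p. 27–28] [cite: DupuyHilado2025, §3.6, §4.7, §4.9,
§4.10, §4.12] [claim: Mochizuki2012, status: disputed] for every quoted construction. HONEST FRAMING: an UPPER bound on OUR typed
`thetaLocal` at the genuine carriers by volumes of OUR typed containers; nothing here asserts or denies [IUTchIII] Cor. 3.12 or takes
a side on any author; typed ≠ proved; instantiated ≠ endorsed.
-/

noncomputable section

open Set Function NumberField IsDedekindDomain
open scoped Pointwise

namespace Summit.ABC.IUTFork.Thm311.Real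

open Cor312 Cor312Vol Literature.IUT.LogThetaLattice Literature.IUT.LogVolume Literature.IUT.HodgeTheaters
  Literature.NumberTheory.NumberFields

variable {F K Fbar : Type} [Field F] [NumberField F] [Field K] [NumberField K] [Algebra F K]
  [Field Fbar] [Algebra F Fbar] [Algebra K Fbar] {E : WeierstrassCurve F} [E.IsElliptic] {l : ℕ}
  {Pb : BadPlacePredicates K} (D : InitialThetaData F K Fbar E l Pb) {logvK : PadicLogsVal K}
  (hlog : LogvAnalyticVal logvK)
  (t : ∀ (u : FinitePlace ℚ) (_ : Fin (thetaIndexOfInitial D).lstar) (x : (thetaIndexOfInitial D).Fibre (Val.non u)),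
    kOfM D (ratChar u) u (natCast_ratChar_mem u) x)
  (tq : ∀ (u : FinitePlace ℚ) (x : (thetaIndexOfInitial D).Fibre (Val.non u)),
    kOfM D (ratChar u) u (natCast_ratChar_mem u) x)
  (M : Type) [Field M] [NumberField M]
  (archPk : ∀ (j : (thetaIndexOfInitial D).Label) (vQ : (thetaIndexOfInitial D).VQ),
    Set ((logShellsOfInitialDH D logvK).Packet j vQ))
  (archSub : ∀ (j : (thetaIndexOfInitial D).Label) (v : (thetaIndexOfInitial D).V),
    Set ((logShellsOfInitialDH D logvK).Packet j ((thetaIndexOfInitial D).over v)))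
  (Ψ : ℤ → ∀ v : (thetaIndexOfInitial D).V, v ∈ (thetaIndexOfInitial D).Vbad →
    Set ((logShellsOfInitialDH D logvK).StarPacket v))
  (act : ℤ → ∀ v : (thetaIndexOfInitial D).V, v ∈ (thetaIndexOfInitial D).Vbad →
    (logShellsOfInitialDH D logvK).StarPacket v → Module.End ℚ ((logShellsOfInitialDH D logvK).StarPacket v))
  (Mmod : ℤ → ∀ j : (thetaIndexOfInitial D).LabelStar, Set ((logShellsOfInitialDH D logvK).GlobalPacket j.1))
  (region : ℤ → ∀ j : (thetaIndexOfInitial D).LabelStar, FinDivisor M → ∀ vQ : (thetaIndexOfInitial D).VQ,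
    Set ((logShellsOfInitialDH D logvK).Packet j.1 vQ))
  (n : ℤ) {HT : Type} {LogLink : HT → HT → Type} {IsFull : ∀ {s t : HT}, LogLink s t → Prop}
  (lat : LGPGaussianLogThetaLattice LogLink IsFull)
  {Frd : Type} {IsoF : Frd → Frd → Type} {Ob : Frd → Type} {realify : Frd → Frd} {Strip : Type}
  {IsoS : Strip → Strip → Type}
  {Mv : ∀ v : (thetaIndexOfInitial D).V, v ∈ (thetaIndexOfInitial D).Vbad → Type} [∀ v h, Monoid (Mv v h)]
  (sig : GlobalLGPFrobenioidSignature (thetaIndexOfInitial D).lstar (thetaIndexOfInitial D).V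
    (· ∈ (thetaIndexOfInitial D).Vbad) Frd IsoF Ob realify Strip IsoS Mv)
  (split : SplittingMonoids Mv) {ObΔ : Type}
  {N : ∀ v : (thetaIndexOfInitial D).V, v ∈ (thetaIndexOfInitial D).Vbad → Type} [∀ v h, Monoid (N v h)]
  (qData : QPilotData ObΔ N)
  (htq0 : ∀ u x, tq u x ≠ 0) (Sq : Finset (FinitePlace ℚ))
  (htq1 : ∀ (u : FinitePlace ℚ) (x : (thetaIndexOfInitial D).Fibre (Val.non u)), u ∉ Sq → ‖tq u x‖ = 1)

/-! ## §1. The three structural inputs of the generic bound at `settingPrVolSharpM` -/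

/-- **`hframe`**: the hull frame of the summand-route sharp setting at `(j, u)` IS the pulled-back real frame of abc-iut-w5-d166's
presentation `presAtM D hlog u` (abc-iut-c312-7's `Setting.ofComparison` frame over abc-iut-w4-d013's M-level field-factor pieces;
definitional). [claim: Mochizuki2012, status: disputed] -/
theorem frame_settingPrVolSharpM_non (j : (thetaIndexOfInitial D).Label) (u : FinitePlace ℚ) :
    haveI : Fintype ((presAtM D hlog u).factorIdx j) := factorIdxM_fintype D hlog j (Val.non u)
    (settingPrVolSharpM D hlog t tq M archPk archSub Ψ act Mmod region n lat sig split qData htq0 Sq htq1).frame j (Val.non u) =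
      HullFrame.ofComparison ((presAtM D hlog u).factorField j) (fun x => (presAtM D hlog u).factorMap j x) :=
  rfl

/-- **`hvol`**: on direct products over the summands the packet-normalised container's log-volume IS the weighted summand
log-measure of the presentation (abc-iut-c312-5's `SummandPieces.logvol_preimage_pi` for abc-iut-w4-d013's `summandPiecesPrM`; the
finite-sum instance on the tuples is irrelevant). [claim: Mochizuki2012, status: disputed] -/
theorem logvol_situationPrVolM_preimage_pi (j : (thetaIndexOfInitial D).Label) (u : FinitePlace ℚ)
    [Fintype ((thetaIndexOfInitial D).Caps j → (thetaIndexOfInitial D).Fibre (Val.non u))]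
    (R : ∀ e : (thetaIndexOfInitial D).Caps j → (thetaIndexOfInitial D).Fibre (Val.non u), Set ((presAtM D hlog u).X e))
    (hR : ∀ e, PacketAdm (ratChar u) ((presAtM D hlog u).kk e) (R e)) :
    ((situationPrVolM D hlog M archPk archSub Ψ act Mmod region).D n).logvol j (Val.non u)
        ((presAtM D hlog u).comparison j ⁻¹' Set.pi univ R) =
      ∑ e, (presAtM D hlog u).w j e * packetLogμ (ratChar u) ((presAtM D hlog u).kk e) (R e) := by
  refine (SummandPieces.logvol_preimage_pi (summandPiecesPrM D hlog) j (Val.non u) (R := R) hR).trans ?_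
  exact Finset.sum_congr (by congr 1; exact Subsingleton.elim _ _) fun _ _ => rfl

/-- **`h3`**: the (Ind3)-enlarged Θ-region at `(i+1, u)` lies in `e⁻¹(Π_{v⃗} p_u^{m(v⃗)}·log_{p_u}(R_{v⃗}^×))` as soon as every SLOT
UNION `⋃_a ι_a(t_{Θ,i+1,v̲_a})·(R_I)^∼` does: the region IS `e⁻¹(Π_{v⃗} ι_{i+1}(t_{Θ,i+1,v̲_{i+1}})·(R_I)^∼)` (sharp box, last slot).
[cite: DupuyHilado2025, §3.9, §4.10] -/
theorem thetaRegion3_settingPrVolSharpM_subset_preimage_pi (i : Fin (thetaIndexOfInitial D).lstar) (u : FinitePlace ℚ)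
    (W : ∀ e : (thetaIndexOfInitial D).Caps (Setting.labelSucc i) → (thetaIndexOfInitial D).Fibre (Val.non u),
      Set ((presAtM D hlog u).X e))
    (hsub : ∀ e : (thetaIndexOfInitial D).Caps (Setting.labelSucc i) → (thetaIndexOfInitial D).Fibre (Val.non u),
      (⋃ a, iota (ratChar u) ((presAtM D hlog u).kk e) a (t u i (e a)) •
          (normalizedPacket (ratChar u) ((presAtM D hlog u).kk e) : Set ((presAtM D hlog u).X e))) ⊆ W e) :
    (settingPrVolSharpM D hlog t tq M archPk archSub Ψ act Mmod region n lat sig split qData htq0 Sq htq1).thetaRegion3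
        (Setting.labelSucc i) (Val.non u) ⊆
      (presAtM D hlog u).comparison (Setting.labelSucc i) ⁻¹' Set.pi univ W := by
  rw [thetaRegion3_settingPrVolSharpM, thetaBoxM_non_eq]
  show (fun x => (presAtM D hlog u).factorMap (Setting.labelSucc i) x) ⁻¹'
      (presAtM D hlog u).boxOf ((presAtM D hlog u).sharpBox (t u) (Setting.labelSucc i)) ⊆ _
  rw [(presAtM D hlog u).factorMap_preimage_boxOf]
  refine Set.preimage_mono (Set.pi_mono fun e _ => ?_)
  refine Set.Subset.trans ?_ (hsub e)
  intro y hy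
  refine Set.mem_iUnion.mpr ⟨Fin.last _, ?_⟩
  have hb : (presAtM D hlog u).sharpBox (t u) (Setting.labelSucc i) e =
      iota (ratChar u) ((presAtM D hlog u).kk e) (Fin.last _) (t u i (e (Fin.last _))) •
        (normalizedPacket (ratChar u) ((presAtM D hlog u).kk e) : Set ((presAtM D hlog u).X e)) := by
    rw [PadicPresentation.sharpBox, PadicPresentation.labelIdele_labelSucc]
  rwa [hb] at hy

/-! ## §2. The content-hull bound at `settingPrVolSharpM` (and at the lead's `settingMSharp`) -/

/-- **P6-instA — the Θ-side local term of the summand-route M-level sharp setting is bounded by the CONTENT HULLS**: for every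
label `j = i+1 ∈ 𝔽_l^⋇`, finite rational place `u` and capsule-symmetric integer family `m(v⃗)` with
`⋃_a ι_a(t_{Θ,i+1,v̲_a})·(R_I)^∼ ⊆ p_u^{m(v⃗)}·log_{p_u}(R_{v⃗}^×)` at every summand `v⃗ : S^±_{j+1} → V̲_u`,
`(−|log(Θ)|_{i+1,u}).untopD 0 ≤ Σ_{v⃗} weightM(v⃗)·(−m(v⃗)·log p_u + log μ̄_{v⃗}(hull(log_{p_u}(R_{v⃗}^×))))` — abc-iut-s2-p7's generic
`thetaLocal_untopD_le_sum_content_hull` with `hframe := rfl`, `hvol := SummandPieces.logvol_preimage_pi`, `BridgeHyps :=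
bridgeHyps_settingPrVolSharpM_of_ideles`, `h3 :=` the last slot of the slot union ([IUTchIV] Thm. 1.10 Step (v)).
[cite: Mochizuki2012, IUTchIV Thm. 1.10 Step (v) p. 27–28] -/
theorem thetaLocal_settingPrVolSharpM_untopD_le_sum_content (ht0 : ∀ u i x, t u i x ≠ 0) (Sθ : Finset (FinitePlace ℚ))
    (ht1 : ∀ (u : FinitePlace ℚ) (i : Fin (thetaIndexOfInitial D).lstar) (x : (thetaIndexOfInitial D).Fibre (Val.non u)),
      u ∉ Sθ → ‖t u i x‖ = 1)
    (i : Fin (thetaIndexOfInitial D).lstar) (u : FinitePlace ℚ)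
    [Fintype ((thetaIndexOfInitial D).Fibre (Val.non u))]
    (m : ((thetaIndexOfInitial D).Caps (Setting.labelSucc i) → (thetaIndexOfInitial D).Fibre (Val.non u)) → ℤ)
    (hm : ∀ (σ : Equiv.Perm ((thetaIndexOfInitial D).Caps (Setting.labelSucc i)))
      (e : (thetaIndexOfInitial D).Caps (Setting.labelSucc i) → (thetaIndexOfInitial D).Fibre (Val.non u)), m (e ∘ σ) = m e)
    (hsub : ∀ e : (thetaIndexOfInitial D).Caps (Setting.labelSucc i) → (thetaIndexOfInitial D).Fibre (Val.non u),
      (⋃ a, iota (ratChar u) ((presAtM D hlog u).kk e) a (t u i (e a)) •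
          (normalizedPacket (ratChar u) ((presAtM D hlog u).kk e) : Set ((presAtM D hlog u).X e))) ⊆
        ((ratChar u : ℚ_[ratChar u]) ^ m e) •
          (logPacket (ratChar u) ((presAtM D hlog u).kk e) : Set ((presAtM D hlog u).X e))) :
    ((settingPrVolSharpM D hlog t tq M archPk archSub Ψ act Mmod region n lat sig split qData htq0 Sq htq1).thetaLocal
        (Setting.labelSucc i) (Val.non u)).untopD 0 ≤
      ∑ e : (thetaIndexOfInitial D).Caps (Setting.labelSucc i) → (thetaIndexOfInitial D).Fibre (Val.non u),
        weightM D u (Setting.labelSucc i) e * (-(m e * Real.log (ratChar u)) +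
          packetLogμ (ratChar u) ((presAtM D hlog u).kk e)
            (packetHull (ratChar u) ((presAtM D hlog u).kk e)
              (logPacket (ratChar u) ((presAtM D hlog u).kk e) : Set ((presAtM D hlog u).X e)))) :=
  letI : Fintype ((presAtM D hlog u).factorIdx (Setting.labelSucc i)) :=
    factorIdxM_fintype D hlog (Setting.labelSucc i) (Val.non u)
  Cor312Vol.thetaLocal_untopD_le_sum_content_hull
    (P := settingPrVolSharpM D hlog t tq M archPk archSub Ψ act Mmod region n lat sig split qData htq0 Sq htq1)
    (presAtM D hlog u)
    (bridgeHyps_settingPrVolSharpM_of_ideles D hlog t tq M archPk archSub Ψ act Mmod region n lat sig split qData htq0 Sq htq1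
      ht0 Sθ ht1)
    i (frame_settingPrVolSharpM_non D hlog t tq M archPk archSub Ψ act Mmod region n lat sig split qData htq0 Sq htq1 _ u)
    (fun R hR => logvol_situationPrVolM_preimage_pi D hlog M archPk archSub Ψ act Mmod region n _ u R hR) m hm
    (thetaRegion3_settingPrVolSharpM_subset_preimage_pi D hlog t tq M archPk archSub Ψ act Mmod region n lat sig split qData
      htq0 Sq htq1 i u _ hsub)

/-- The `WithTop` form of P6-instA (abc-iut-s2-p7 `thetaLocal_le_coe_of_untopD_le`): the local Θ-volume at `(i+1, u)` is at most
the content-hull sum, as a `WithTop ℝ` inequality — the shape of hypothesis (hA) of abc-iut-w5-d166's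
`negLogTheta_le_genuine_of_local_bounds` once the right-hand side is identified with `orbitSumM` (unit P6-instB).
[cite: Mochizuki2012, IUTchIV Thm. 1.10 Step (v) p. 27–28] -/
theorem thetaLocal_settingPrVolSharpM_le_coe_sum_content (ht0 : ∀ u i x, t u i x ≠ 0) (Sθ : Finset (FinitePlace ℚ))
    (ht1 : ∀ (u : FinitePlace ℚ) (i : Fin (thetaIndexOfInitial D).lstar) (x : (thetaIndexOfInitial D).Fibre (Val.non u)),
      u ∉ Sθ → ‖t u i x‖ = 1)
    (i : Fin (thetaIndexOfInitial D).lstar) (u : FinitePlace ℚ)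
    [Fintype ((thetaIndexOfInitial D).Fibre (Val.non u))]
    (m : ((thetaIndexOfInitial D).Caps (Setting.labelSucc i) → (thetaIndexOfInitial D).Fibre (Val.non u)) → ℤ)
    (hm : ∀ (σ : Equiv.Perm ((thetaIndexOfInitial D).Caps (Setting.labelSucc i)))
      (e : (thetaIndexOfInitial D).Caps (Setting.labelSucc i) → (thetaIndexOfInitial D).Fibre (Val.non u)), m (e ∘ σ) = m e)
    (hsub : ∀ e : (thetaIndexOfInitial D).Caps (Setting.labelSucc i) → (thetaIndexOfInitial D).Fibre (Val.non u),
      (⋃ a, iota (ratChar u) ((presAtM D hlog u).kk e) a (t u i (e a)) •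
          (normalizedPacket (ratChar u) ((presAtM D hlog u).kk e) : Set ((presAtM D hlog u).X e))) ⊆
        ((ratChar u : ℚ_[ratChar u]) ^ m e) •
          (logPacket (ratChar u) ((presAtM D hlog u).kk e) : Set ((presAtM D hlog u).X e))) :
    (settingPrVolSharpM D hlog t tq M archPk archSub Ψ act Mmod region n lat sig split qData htq0 Sq htq1).thetaLocal
        (Setting.labelSucc i) (Val.non u) ≤
      ((∑ e : (thetaIndexOfInitial D).Caps (Setting.labelSucc i) → (thetaIndexOfInitial D).Fibre (Val.non u),
        weightM D u (Setting.labelSucc i) e * (-(m e * Real.log (ratChar u)) +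
          packetLogμ (ratChar u) ((presAtM D hlog u).kk e)
            (packetHull (ratChar u) ((presAtM D hlog u).kk e)
              (logPacket (ratChar u) ((presAtM D hlog u).kk e) : Set ((presAtM D hlog u).X e)))) : ℝ) : WithTop ℝ) :=
  Cor312Vol.thetaLocal_le_coe_of_untopD_le
    (bridgeHyps_settingPrVolSharpM_of_ideles D hlog t tq M archPk archSub Ψ act Mmod region n lat sig split qData htq0 Sq htq1
      ht0 Sθ ht1) i (Val.non u)
    (thetaLocal_settingPrVolSharpM_untopD_le_sum_content D hlog t tq M archPk archSub Ψ act Mmod region n lat sig split qData htq0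
      Sq htq1 ht0 Sθ ht1 i u m hm hsub)

/-- **The same bound for the lead's frames-route sharp setting `settingMSharp`** (abc-iut-w4-d013's two-routes identity
`thetaLocal_settingMSharp_eq`, p437121, read through `thetaLocal_settingMSharp_eq_settingPrVolSharpM`): its local Θ-volume at
`(i+1, u)` is at most the content-hull sum. [cite: Mochizuki2012, IUTchIV Thm. 1.10 Step (v) p. 27–28] -/
theorem thetaLocal_settingMSharp_le_coe_sum_content (ht0 : ∀ u i x, t u i x ≠ 0) (Sθ : Finset (FinitePlace ℚ))
    (ht1 : ∀ (u : FinitePlace ℚ) (i : Fin (thetaIndexOfInitial D).lstar) (x : (thetaIndexOfInitial D).Fibre (Val.non u)),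
      u ∉ Sθ → ‖t u i x‖ = 1)
    (i : Fin (thetaIndexOfInitial D).lstar) (u : FinitePlace ℚ)
    [Fintype ((thetaIndexOfInitial D).Fibre (Val.non u))]
    (m : ((thetaIndexOfInitial D).Caps (Setting.labelSucc i) → (thetaIndexOfInitial D).Fibre (Val.non u)) → ℤ)
    (hm : ∀ (σ : Equiv.Perm ((thetaIndexOfInitial D).Caps (Setting.labelSucc i)))
      (e : (thetaIndexOfInitial D).Caps (Setting.labelSucc i) → (thetaIndexOfInitial D).Fibre (Val.non u)), m (e ∘ σ) = m e)
    (hsub : ∀ e : (thetaIndexOfInitial D).Caps (Setting.labelSucc i) → (thetaIndexOfInitial D).Fibre (Val.non u),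
      (⋃ a, iota (ratChar u) ((presAtM D hlog u).kk e) a (t u i (e a)) •
          (normalizedPacket (ratChar u) ((presAtM D hlog u).kk e) : Set ((presAtM D hlog u).X e))) ⊆
        ((ratChar u : ℚ_[ratChar u]) ^ m e) •
          (logPacket (ratChar u) ((presAtM D hlog u).kk e) : Set ((presAtM D hlog u).X e))) :
    (settingMSharp D hlog M archPk archSub Ψ act Mmod region n lat sig split qData t tq htq0 Sq htq1).thetaLocal
        (Setting.labelSucc i) (Val.non u) ≤
      ((∑ e : (thetaIndexOfInitial D).Caps (Setting.labelSucc i) → (thetaIndexOfInitial D).Fibre (Val.non u),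
        weightM D u (Setting.labelSucc i) e * (-(m e * Real.log (ratChar u)) +
          packetLogμ (ratChar u) ((presAtM D hlog u).kk e)
            (packetHull (ratChar u) ((presAtM D hlog u).kk e)
              (logPacket (ratChar u) ((presAtM D hlog u).kk e) : Set ((presAtM D hlog u).X e)))) : ℝ) : WithTop ℝ) := by
  rw [thetaLocal_settingMSharp_eq_settingPrVolSharpM]
  exact thetaLocal_settingPrVolSharpM_le_coe_sum_content D hlog t tq M archPk archSub Ψ act Mmod region n lat sig split qData htq0
    Sq htq1 ht0 Sθ ht1 i u m hm hsub

end Summit.ABC.IUTFork.Thm311.Real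

end
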